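import Literature.AlgebraicTopology.SingularHomology.IsotopyLocalClass
import Literature.AlgebraicGeometry.HodgeTheory.HolomorphicChartComplexOrientation
import Literature.AlgebraicGeometry.HodgeTheory.GlobalInvariantCyclesProofs
import Literature.AlgebraicGeometry.HodgeTheory.HodgeLocus
import Mathlib.Analysis.Calculus.InverseFunctionTheorem.FDeriv
import HarnessLib

/-!
# An isotopy of fibre embeddings through a smooth family carries the complex local orientation class of
# one fibre to that of the other

Family `hodge`, layer `Literature/AlgebraicGeometry/HodgeTheory`, sub-namespace
`…HodgeTheory.SmoothFamilyFibreClass`. THEOREMS ONLY (no definition, no named fact). Third file of the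
Literature home of the discharge of `Fulton1998_map_fundamentalClass_fibre_eq`
(`SmoothFamilyFibreClasses`; apex `SmoothFamilyFibreClassesHolds`).

The heart of "the homology class of a fibre does not depend on the fibre" (Fulton, *Intersection Theory*,
§19.1 proof of Prop. 19.1.1; Voisin, *Hodge Theory I*, §9.1.1 Ehresmann + §11.1.2 complex orientation) on
the tree's carriers: let `f : 𝒳 ⟶ S`, `𝒳` smooth of relative dimension `N` over `ℂ`, with fibres
`𝒳_{t₀}`, `𝒳_u` smooth of relative dimension `n`; let `q = p ∘ a_Q` be a LINEAR projection of the
algebraic coordinates of `𝒳(ℂ)` at `Q` which is injective on the fibres of `f(ℂ)` inside an open `W`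
(`SubmersionFibrewiseLinearChart`); let `θ : [0,1] × 𝒳_{t₀}(ℂ) → 𝒳(ℂ)` be an isotopy of injections
starting at the fibre inclusion `j_{t₀}`, fibrewise (each `θ_s` lands in one fibre of `f(ℂ)`), keeping a
neighbourhood `K₀` of `x₀` inside `W`, and ending at `j_u ∘ Ψ` for a homeomorphism
`Ψ : 𝒳_{t₀}(ℂ) ≃ 𝒳_u(ℂ)` (Ehresmann transport along a path from `t₀` to `u`). Then

* `map_localClass_eq_of_fibre_isotopy` — **`Ψ_* μ_{t₀, x₀} = μ_{u, Ψ x₀}`** for the complex orientations of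
  the two fibres: the charts `q ∘ j_{t₀}`, `q ∘ j_u` are holomorphic in the fibres' algebraic atlases
  (GAGA, `contDiffOn_chart_map`) and injective, hence local biholomorphisms computing the complex local
  classes (`exists_fibre_holomorphicChart`, `HolomorphicChartComplexOrientation`), and in these charts `Ψ`
  reads as the end of the isotopy `v ↦ q(θ_s(x))` through injections from the identity, of local degree
  `+1` (`SingularHomology/IsotopyLocalClass`).

Also `map_localClass_eq_of_transition'` (the compatible-charts lemma of `IsotopyLocalClass` with the target
chart computing the orientation at the one point `e x` only — all its proof uses).

Provenance: Literature home of the Summits-side `Theorems/Ring2AbelianAllAndreFibreOrientationTransport`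
(cell Ring 2 · AbelianAll, André axis), which `Literature/` may not import. Lane `lit-hodgefound`, seat p20.

## References

* [Fulton1998] W. Fulton, Intersection Theory, 2nd ed., Springer 1998, §19.1 (proof of Prop. 19.1.1).
* [VoisinHodgeI2002] C. Voisin, Hodge Theory and Complex Algebraic Geometry I, CUP 2002, §9.1.1, §11.1.2.
* [MilnorStasheff1974] J. Milnor, J. Stasheff, Characteristic Classes, PUP 1974, §13 p. 151.
* [HatcherAT2002] A. Hatcher, Algebraic Topology, CUP 2002, §2.1 Prop. 2.19, §3.3 pp. 231–236.
* [Bredon1993] G. E. Bredon, Topology and Geometry, GTM 139, Springer 1993, VI.7.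
* [SerreGAGA1956] J.-P. Serre, GAGA, Ann. Inst. Fourier 6 (1956), §2 n°5 Prop. 2.
-/

noncomputable section

open CategoryTheory AlgebraicGeometry Set Filter Topology
open scoped ContDiff unitInterval
open Literature.AlgebraicGeometry Literature.AlgebraicGeometry.Motives
open Literature.AlgebraicGeometry.HodgeTheory
open Literature.AlgebraicTopology.SingularHomology Literature.AlgebraicTopology.SingularHomology.IsotopyLocalClass

namespace Literature.AlgebraicGeometry.HodgeTheory.SmoothFamilyFibreClass

universe u

/-! ## §0 The compatible-charts lemma with a pointwise hypothesis on the target chart -/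

section Transition

variable {k : ℕ} {X' X : Type u} [TopologicalSpace X'] [T2Space X'] [TopologicalSpace X] [T2Space X]

/-- `IsotopyLocalClass.map_localClass_eq_of_transition` with the target chart `c` only assumed to compute the
orientation `μ` at the point `e x` (the only point its proof uses). [cite: Bredon1993, VI.7]
[cite: HatcherAT2002, §3.3 p. 231] -/
theorem map_localClass_eq_of_transition' (g : HomologicalOrientation ℤ (EuclideanSpace ℝ (Fin k)) k)
    (μ' : HomologicalOrientation ℤ X' k) (μ : HomologicalOrientation ℤ X k)
    (e : OpenPartialHomeomorph X' X) (hec : Continuous e) {x : X'} (hx : x ∈ e.source)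
    (hfib : MapsTo e ({x}ᶜ : Set X') ({e x}ᶜ : Set X))
    (c' : OpenPartialHomeomorph X' (EuclideanSpace ℝ (Fin k))) (hx' : x ∈ c'.source)
    (hμ' : μ'.localClass x = (localHomology.chartXEquiv ℤ ℤ c' hx' k).symm (g.localClass (c' x)))
    (c : OpenPartialHomeomorph X (EuclideanSpace ℝ (Fin k))) (hxc : e x ∈ c.source)
    (hμ : μ.localClass (e x) = (localHomology.chartXEquiv ℤ ℤ c hxc k).symm (g.localClass (c (e x))))
    (hp : c' x ∈ (c'.restrOpen (e.trans c).source (e.trans c).open_source).target)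
    (h : MapsTo (fun v : ↥(c'.restrOpen (e.trans c).source (e.trans c).open_source).target =>
        (e.trans c) (c'.symm v))
      ({(⟨c' x, hp⟩ : ↥(c'.restrOpen (e.trans c).source (e.trans c).open_source).target)}ᶜ)
      ({c (e x)}ᶜ : Set (EuclideanSpace ℝ (Fin k))))
    (htrans : relativeSingularHomology.map ℤ ℤ
        (⟨fun v : ↥(c'.restrOpen (e.trans c).source (e.trans c).open_source).target =>
            (e.trans c) (c'.symm v),
          ((e.trans c).continuousOn.comp (c'.continuousOn_symm.mono inter_subset_left)
            (fun v (hv : v ∈ c'.target ∩ c'.symm ⁻¹' (e.trans c).source) => hv.2)).restrict⟩ :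
          C(↥(c'.restrOpen (e.trans c).source (e.trans c).open_source).target, EuclideanSpace ℝ (Fin k)))
        h k
        ((localHomology.openSubsetIso ℤ ℤ
          (c'.restrOpen (e.trans c).source (e.trans c).open_source).open_target hp k).inv
          (g.localClass (c' x))) =
      g.localClass (c (e x))) :
    relativeSingularHomology.map ℤ ℤ (⟨e, hec⟩ : C(X', X)) hfib k (μ'.localClass x) =
      μ.localClass (e x) := by
  have hx₂ : x ∈ (e.trans c).source := ⟨hx, hxc⟩
  have key : (localHomology.chartXEquiv ℤ ℤ c' hx' k).symm (g.localClass (c' x)) =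
      (localHomology.chartXEquiv ℤ ℤ (e.trans c) hx₂ k).symm (g.localClass ((e.trans c) x)) := by
    rw [LinearEquiv.eq_symm_apply, chartXEquiv_apply_chartXEquiv_symm (e.trans c) c' hx₂ hx' hp h]
    exact htrans
  rw [hμ', key, hμ]
  exact localHomology.map_chartXEquiv_trans_symm e hec c hx₂ hfib k _

end Transition

/-! ## §1 Holomorphic charts of the fibres induced from a fibrewise-injective linear chart of the total space -/

section Fibres

variable {n N : ℕ} {𝒳 S : SchemeOver ℂ} [LocallyOfFiniteType 𝒳.hom] [SmoothOfRelativeDimension N 𝒳.hom]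
  {f : 𝒳 ⟶ S}

/-- **The linear chart restricted to a fibre is a local biholomorphism in the fibre's algebraic atlas.**
With `q = p ∘ a_Q` injective on the fibres of `f(ℂ)` inside the open `W ⊆ a_Q.source`, for a point `y` of
the fibre `𝒳_t` with `j_t y ∈ W` the map `h = q ∘ j_t ∘ a_y⁻¹ : ℂⁿ → ℂⁿ` (`a_y` the algebraic chart of
`𝒳_t(ℂ)` at `y`) is holomorphic (GAGA: `j_t` is holomorphic in algebraic charts, the tree's
`contDiffOn_chart_map`) and injective near `a_y y`, hence has an invertible differential there (the
tree's `SCV.bijective_fderiv_of_injOn`, Osgood) and restricts to an open partial homeomorphism `T` with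
`⇑T = h`, `a_y y ∈ T.source`, whose inverse is `ℂ`-differentiable at `T (a_y y)` with invertible
derivative (inverse function theorem). [cite: SerreGAGA1956, §2 n°5 Prop. 2] [cite: VoisinHodgeI2002, §9.1.1] -/
theorem exists_fibre_holomorphicChart {t : ComplexPoints S} [LocallyOfFiniteType (fiberOver f t).hom]
    [SmoothOfRelativeDimension n (fiberOver f t).hom]
    (Q : ComplexPoints 𝒳) {W : Set (ComplexPoints 𝒳)} (hWo : IsOpen W)
    (hWa : W ⊆ (ComplexPoints.algebraicChart 𝒳 N Q).source) (p : (Fin N → ℂ) →L[ℂ] (Fin n → ℂ))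
    (hinj : InjOn (fun y => (AlgPoints.map f y, p (ComplexPoints.algebraicChart 𝒳 N Q y))) W)
    (y : ComplexPoints (fiberOver f t)) (hy : AlgPoints.map (fiberι f t) y ∈ W) :
    ∃ (T : OpenPartialHomeomorph (Fin n → ℂ) (Fin n → ℂ)) (B : (Fin n → ℂ) ≃L[ℂ] (Fin n → ℂ)),
      (⇑T = fun z => p (ComplexPoints.algebraicChart 𝒳 N Q (AlgPoints.map (fiberι f t)
        ((ComplexPoints.algebraicChart (fiberOver f t) n y).symm z)))) ∧
      ComplexPoints.algebraicChart (fiberOver f t) n y y ∈ T.source ∧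
      HasFDerivAt T.symm (B : (Fin n → ℂ) →L[ℂ] (Fin n → ℂ))
        (T (ComplexPoints.algebraicChart (fiberOver f t) n y y)) := by
  set a := ComplexPoints.algebraicChart (fiberOver f t) n y with ha
  set aX := ComplexPoints.algebraicChart 𝒳 N Q with haX
  set j : ComplexPoints (fiberOver f t) → ComplexPoints 𝒳 := AlgPoints.map (fiberι f t) with hj
  set h : (Fin n → ℂ) → (Fin n → ℂ) := fun z => p (aX (j (a.symm z))) with hh
  set O : Set (Fin n → ℂ) := a.target ∩ a.symm ⁻¹' (j ⁻¹' W) with hO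
  have hOo : IsOpen O := a.isOpen_inter_preimage_symm (hWo.preimage (AlgPoints.continuous_map _))
  have hya : y ∈ a.source := ComplexPoints.mem_algebraicChart_source _ n y
  have hz : a y ∈ O := ⟨a.map_source hya, by rw [mem_preimage, a.left_inv hya]; exact hy⟩
  have hcd : ContDiffOn ℂ ω h O := by
    have h1 := ComplexPoints.contDiffOn_chart_map (n := n) (m := N) (fiberι f t) y Q
    exact p.contDiff.comp_contDiffOn (h1.mono fun z hz => ⟨hz.1, hWa hz.2⟩)
  have hdiff : DifferentiableOn ℂ h O := hcd.differentiableOn (by simp)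
  have hinjh : InjOn h O := by
    intro z hz z' hz' hzz'
    have hw : j (a.symm z) ∈ W := hz.2
    have hw' : j (a.symm z') ∈ W := hz'.2
    have hF : AlgPoints.map f (j (a.symm z)) = AlgPoints.map f (j (a.symm z')) := by
      rw [hj, AlgPoints.map_map_fiberι, AlgPoints.map_map_fiberι]
    have h1 : j (a.symm z) = j (a.symm z') := hinj hw hw' (Prod.ext hF hzz')
    have h2 : a.symm z = a.symm z' := AlgPoints.map_fiberι_injective f t h1
    exact a.symm.injOn hz.1 hz'.1 h2
  have hbij := Literature.Analysis.Complex.SCV.bijective_fderiv_of_injOn rfl hdiff hOo hinjh hz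
  have hbij' : Function.Bijective ((fderiv ℂ h (a y) : (Fin n → ℂ) →L[ℂ] (Fin n → ℂ)) :
      (Fin n → ℂ) →ₗ[ℂ] (Fin n → ℂ)) := hbij
  set B : (Fin n → ℂ) ≃L[ℂ] (Fin n → ℂ) :=
    (LinearEquiv.ofBijective _ hbij').toContinuousLinearEquiv with hB
  have hBcoe : (B : (Fin n → ℂ) →L[ℂ] (Fin n → ℂ)) = fderiv ℂ h (a y) := by
    ext1 v
    rfl
  have hstrict : HasStrictFDerivAt h (B : (Fin n → ℂ) →L[ℂ] (Fin n → ℂ)) (a y) := by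
    rw [hBcoe]
    exact (hcd.contDiffAt (hOo.mem_nhds hz)).hasStrictFDerivAt (by simp)
  refine ⟨hstrict.toOpenPartialHomeomorph h, B.symm, rfl, hstrict.mem_toOpenPartialHomeomorph_source, ?_⟩
  exact hstrict.to_localInverse.hasFDerivAt

end Fibres

/-! ## §2 The isotopy of fibre embeddings carries the complex local class across -/

section Isotopy

variable {n N : ℕ} {𝒳 S : SchemeOver ℂ} [LocallyOfFiniteType 𝒳.hom] [SmoothOfRelativeDimension N 𝒳.hom]
  {f : 𝒳 ⟶ S}

/-- **Transport of the complex local orientation class along an isotopy of fibre embeddings.** In the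
situation of the module docstring (`q = p ∘ a_Q` injective on the fibres of `f(ℂ)` inside the open
`W ⊆ a_Q.source`; `θ : [0,1] × 𝒳_{t₀}(ℂ) → 𝒳(ℂ)` continuous, `θ(0, ·) = j_{t₀}`, each `θ(s, ·)` injective
with values in one fibre of `f(ℂ)`, `θ(s, K₀) ⊆ W` for an open `K₀ ∋ x₀`; `Ψ : 𝒳_{t₀}(ℂ) ≃ 𝒳_u(ℂ)` with
`j_u ∘ Ψ = θ(1, ·)`): **`Ψ_* μ_{x₀} = μ_{Ψ x₀}`** for the complex orientations (positive holomorphic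
algebraic atlases, same generator) of the fibres `𝒳_{t₀}(ℂ)`, `𝒳_u(ℂ)`. This is the step "the
trivialisation preserves the complex orientations of the fibres" of Fulton §19.1 / Voisin I §9.1.1 +
§11.1.2, proved by `IsotopyLocalClass.map_localClass_eq_of_isotopy` (isotopy ⇒ local degree `+1`),
`complexPoints_localClass_eq_of_holomorphicChart` (holomorphic charts compute the complex orientation) and
`exists_fibre_holomorphicChart`. [cite: Fulton1998, §19.1 proof of Prop. 19.1.1]
[cite: VoisinHodgeI2002, §9.1.1 and §11.1.2] [cite: MilnorStasheff1974, §13 p. 151] -/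
theorem map_localClass_eq_of_fibre_isotopy [IsSeparated 𝒳.hom] {t₀ u : ComplexPoints S}
    [LocallyOfFiniteType (fiberOver f t₀).hom] [SmoothOfRelativeDimension n (fiberOver f t₀).hom]
    [IsSeparated (fiberOver f t₀).hom]
    [LocallyOfFiniteType (fiberOver f u).hom] [SmoothOfRelativeDimension n (fiberOver f u).hom]
    [IsSeparated (fiberOver f u).hom]
    (Q : ComplexPoints 𝒳) {W : Set (ComplexPoints 𝒳)} (hWo : IsOpen W)
    (hWa : W ⊆ (ComplexPoints.algebraicChart 𝒳 N Q).source) (p : (Fin N → ℂ) →L[ℂ] (Fin n → ℂ))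
    (hinj : InjOn (fun y => (AlgPoints.map f y, p (ComplexPoints.algebraicChart 𝒳 N Q y))) W)
    (θ : I × ComplexPoints (fiberOver f t₀) → ComplexPoints 𝒳) (hθ : Continuous θ)
    (hθ0 : ∀ x, θ (0, x) = AlgPoints.map (fiberι f t₀) x)
    (hθinj : ∀ s : I, Function.Injective fun x => θ (s, x))
    (hθF : ∀ (s : I) (x x' : ComplexPoints (fiberOver f t₀)),
      AlgPoints.map f (θ (s, x)) = AlgPoints.map f (θ (s, x')))
    {K₀ : Set (ComplexPoints (fiberOver f t₀))} (hK₀ : IsOpen K₀)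
    {x₀ : ComplexPoints (fiberOver f t₀)} (hx₀ : x₀ ∈ K₀) (hθW : ∀ (s : I), ∀ x ∈ K₀, θ (s, x) ∈ W)
    (Ψ : ComplexPoints (fiberOver f t₀) ≃ₜ ComplexPoints (fiberOver f u))
    (hΨ : ∀ x, AlgPoints.map (fiberι f u) (Ψ x) = θ (1, x)) :
    letI := ComplexPoints.chartedSpace (fiberOver f t₀) n
    letI := ComplexPoints.chartedSpace (fiberOver f u) n
    haveI := ComplexPoints.t2Space_of_isSeparated (fiberOver f t₀)
    haveI := ComplexPoints.t2Space_of_isSeparated (fiberOver f u)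
    relativeSingularHomology.map ℤ ℤ (Ψ : C(ComplexPoints (fiberOver f t₀), ComplexPoints (fiberOver f u)))
        (mapsTo_compl_singleton_of_injective Ψ.injective rfl) (2 * n)
        ((positiveAtlasOrientation (isPositiveAtlas_complexPoints_of_smooth (fiberOver f t₀) n)
          (euclideanGenerator (2 * n))).localClass x₀) =
      (positiveAtlasOrientation (isPositiveAtlas_complexPoints_of_smooth (fiberOver f u) n)
        (euclideanGenerator (2 * n))).localClass (Ψ x₀) := by
  letI := ComplexPoints.chartedSpace (fiberOver f t₀) n
  letI := ComplexPoints.chartedSpace (fiberOver f u) n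
  haveI := ComplexPoints.t2Space_of_isSeparated (fiberOver f t₀)
  haveI := ComplexPoints.t2Space_of_isSeparated (fiberOver f u)
  set g := euclideanGenerator (2 * n) with hg
  set μ₀ := positiveAtlasOrientation (isPositiveAtlas_complexPoints_of_smooth (fiberOver f t₀) n) g
    with hμ₀def
  set μ₁ := positiveAtlasOrientation (isPositiveAtlas_complexPoints_of_smooth (fiberOver f u) n) g
    with hμ₁def
  set L := complexToEuclideanCLE n with hL
  set aX := ComplexPoints.algebraicChart 𝒳 N Q with haX
  set j₀ : ComplexPoints (fiberOver f t₀) → ComplexPoints 𝒳 := AlgPoints.map (fiberι f t₀) with hj₀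
  set j₁ : ComplexPoints (fiberOver f u) → ComplexPoints 𝒳 := AlgPoints.map (fiberι f u) with hj₁
  set y₁ := Ψ x₀ with hy₁
  have hx₀W : j₀ x₀ ∈ W := by rw [← hθ0]; exact hθW 0 x₀ hx₀
  have hy₁W : j₁ y₁ ∈ W := by rw [hy₁, hΨ]; exact hθW 1 x₀ hx₀
  -- holomorphic charts of the two fibres at `x₀` and `y₁ = Ψ x₀`
  obtain ⟨T₀, B₀, hT₀, hT₀src, hB₀⟩ := exists_fibre_holomorphicChart (n := n) Q hWo hWa p hinj x₀ hx₀W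
  obtain ⟨T₁, B₁, hT₁, hT₁src, hB₁⟩ := exists_fibre_holomorphicChart (n := n) Q hWo hWa p hinj y₁ hy₁W
  set a₀ := ComplexPoints.algebraicChart (fiberOver f t₀) n x₀ with ha₀
  set a₁ := ComplexPoints.algebraicChart (fiberOver f u) n y₁ with ha₁
  have hx₀a₀ : x₀ ∈ a₀.source := ComplexPoints.mem_algebraicChart_source _ n x₀
  have hy₁a₁ : y₁ ∈ a₁.source := ComplexPoints.mem_algebraicChart_source _ n y₁
  set c₀ := (a₀.trans T₀).transHomeomorph (complexToEuclidean n) with hc₀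
  set c := (a₁.trans T₁).transHomeomorph (complexToEuclidean n) with hc
  have hx₀c₀ : x₀ ∈ c₀.source := ⟨hx₀a₀, hT₀src⟩
  have hy₁c : y₁ ∈ c.source := ⟨hy₁a₁, hT₁src⟩
  have hμ₀ : μ₀.localClass x₀ =
      (localHomology.chartXEquiv ℤ ℤ c₀ hx₀c₀ (2 * n)).symm (g.localClass (c₀ x₀)) :=
    complexPoints_localClass_eq_of_holomorphicChart g x₀ T₀ hT₀src hB₀ hx₀c₀
  have hμ₁ : μ₁.localClass y₁ =
      (localHomology.chartXEquiv ℤ ℤ c hy₁c (2 * n)).symm (g.localClass (c y₁)) :=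
    complexPoints_localClass_eq_of_holomorphicChart g y₁ T₁ hT₁src hB₁ hy₁c
  -- values of the charts
  have hc₀val : ∀ x ∈ a₀.source, c₀ x = L (p (aX (j₀ x))) := by
    intro x hx
    change L (T₀ (a₀ x)) = _
    rw [hT₀]
    change L (p (aX (j₀ (a₀.symm (a₀ x))))) = _
    rw [a₀.left_inv hx]
  have hcval : ∀ y ∈ a₁.source, c y = L (p (aX (j₁ y))) := by
    intro y hy
    change L (T₁ (a₁ y)) = _
    rw [hT₁]
    change L (p (aX (j₁ (a₁.symm (a₁ y))))) = _
    rw [a₁.left_inv hy]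
  -- shrink `c₀` to `K₀`
  set c' := c₀.restrOpen K₀ hK₀ with hc'
  have hx₀c' : x₀ ∈ c'.source := by
    rw [hc', c₀.restrOpen_source]
    exact ⟨hx₀c₀, hx₀⟩
  have hc'src : c'.source ⊆ a₀.source ∩ K₀ := by
    rw [hc', c₀.restrOpen_source]
    exact fun x hx => ⟨hx.1.1, hx.2⟩
  have hμ₀' : μ₀.localClass x₀ =
      (localHomology.chartXEquiv ℤ ℤ c' hx₀c' (2 * n)).symm (g.localClass (c' x₀)) := by
    rw [hμ₀]
    apply (localHomology.chartXEquiv ℤ ℤ c' hx₀c' (2 * n)).injective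
    rw [LinearEquiv.apply_symm_apply]
    have h1 := chartXEquiv_restrOpen c₀ hK₀ hx₀c₀ hx₀ (2 * n)
      ((localHomology.chartXEquiv ℤ ℤ c₀ hx₀c₀ (2 * n)).symm (g.localClass (c₀ x₀)))
    rw [LinearEquiv.apply_symm_apply] at h1
    exact h1
  -- the homeomorphism `Ψ` as an open partial homeomorphism, and the common domain
  set e := Ψ.toOpenPartialHomeomorph with he
  have hec : Continuous e := Ψ.continuous
  have hex₀ : e x₀ = y₁ := rfl
  have hfib : MapsTo e ({x₀}ᶜ : Set (ComplexPoints (fiberOver f t₀))) ({e x₀}ᶜ : Set _) :=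
    mapsTo_compl_singleton_of_injective Ψ.injective rfl
  have hy₁c' : e x₀ ∈ c.source := hy₁c
  set V' := (c'.restrOpen (e.trans c).source (e.trans c).open_source).target with hV'
  have hV'o : IsOpen V' := (c'.restrOpen (e.trans c).source (e.trans c).open_source).open_target
  have hV'sub : ∀ v ∈ V', v ∈ c'.target ∧ c'.symm v ∈ c'.source ∧ Ψ (c'.symm v) ∈ c.source := by
    intro v hv
    have hv' : v ∈ c'.target ∩ c'.symm ⁻¹' (e.trans c).source := hv
    refine ⟨hv'.1, c'.map_target hv'.1, ?_⟩
    have h2 : c'.symm v ∈ (e.trans c).source := hv'.2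
    rw [OpenPartialHomeomorph.trans_source] at h2
    exact h2.2
  have hp' : c' x₀ ∈ V' := by
    change c' x₀ ∈ c'.target ∩ c'.symm ⁻¹' (e.trans c).source
    refine ⟨c'.map_source hx₀c', ?_⟩
    rw [mem_preimage, c'.left_inv hx₀c', OpenPartialHomeomorph.trans_source]
    exact ⟨mem_univ _, hy₁c⟩
  -- the isotopy read in the charts: `H (s, v) = L (q (θ_s (c'⁻¹ v)))`
  have hmemW : ∀ (s : I) (v : ↥V'), θ (s, c'.symm v) ∈ W := fun s v =>
    hθW s _ (hc'src (hV'sub v v.2).2.1).2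
  set H : I × ↥V' → EuclideanSpace ℝ (Fin (2 * n)) := fun sv => L (p (aX (θ (sv.1, c'.symm sv.2))))
    with hH
  have hHc : Continuous H := by
    have h1 : Continuous fun sv : I × ↥V' => θ (sv.1, c'.symm (sv.2 : EuclideanSpace ℝ (Fin (2 * n)))) := by
      refine hθ.comp (continuous_fst.prodMk ?_)
      exact c'.continuousOn_symm.comp_continuous (continuous_subtype_val.comp continuous_snd)
        fun sv => (hV'sub sv.2 sv.2.2).1
    have h2 : Continuous fun sv : I × ↥V' => aX (θ (sv.1, c'.symm (sv.2 : EuclideanSpace ℝ (Fin (2 * n))))) :=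
      aX.continuousOn.comp_continuous h1 fun sv => hWa (hmemW sv.1 sv.2)
    exact L.continuous.comp (p.continuous.comp h2)
  have hH0 : ∀ v : ↥V', H (0, v) = v := by
    intro v
    obtain ⟨hvt, hvs, -⟩ := hV'sub v v.2
    change L (p (aX (θ (0, c'.symm v)))) = (v : EuclideanSpace ℝ (Fin (2 * n)))
    rw [hθ0]
    conv_rhs => rw [← c'.right_inv hvt]
    exact (hc₀val _ (hc'src hvs).1).symm
  have hHinj : ∀ s : I, Function.Injective fun v : ↥V' => H (s, v) := by
    intro s v v' hvv'
    have h1 : p (aX (θ (s, c'.symm v))) = p (aX (θ (s, c'.symm v'))) := L.injective hvv'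
    have h2 : θ (s, c'.symm v) = θ (s, c'.symm v') :=
      hinj (hmemW s v) (hmemW s v') (Prod.ext (hθF s _ _) h1)
    have h3 : c'.symm v = c'.symm v' := hθinj s h2
    exact Subtype.ext (c'.symm.injOn (hV'sub v v.2).1 (hV'sub v' v'.2).1 h3)
  have hq : H (1, ⟨c' x₀, hp'⟩) = c (e x₀) := by
    change L (p (aX (θ (1, c'.symm (c' x₀))))) = c y₁
    rw [c'.left_inv hx₀c', ← hΨ, hcval y₁ hy₁a₁]
  have hmaps : MapsTo (fun v : ↥V' => H (1, v)) ({(⟨c' x₀, hp'⟩ : ↥V')}ᶜ : Set ↥V')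
      ({c (e x₀)}ᶜ : Set (EuclideanSpace ℝ (Fin (2 * n)))) :=
    mapsTo_compl_singleton_of_injective (hHinj 1) hq
  have hiso := map_localClass_eq_of_isotopy g hV'o hp' H hHc hH0 hHinj hq hmaps
  -- the transition map `c ∘ Ψ ∘ c'⁻¹` on `V'` IS the end of the isotopy
  have hptw : ∀ v : ↥V', (e.trans c) (c'.symm v) = H (1, v) := by
    intro v
    obtain ⟨-, -, hvc⟩ := hV'sub v v.2
    change c (Ψ (c'.symm v)) = L (p (aX (θ (1, c'.symm v))))
    rw [hcval _ hvc.1, hΨ]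
  have h : MapsTo (fun v : ↥V' => (e.trans c) (c'.symm v)) ({(⟨c' x₀, hp'⟩ : ↥V')}ᶜ : Set ↥V')
      ({c (e x₀)}ᶜ : Set (EuclideanSpace ℝ (Fin (2 * n)))) := by
    intro v hv
    change (e.trans c) (c'.symm v) ∈ ({c (e x₀)}ᶜ : Set (EuclideanSpace ℝ (Fin (2 * n))))
    rw [hptw v]
    exact hmaps hv
  have hfun : (⟨fun v : ↥V' => (e.trans c) (c'.symm v),
      ((e.trans c).continuousOn.comp (c'.continuousOn_symm.mono inter_subset_left)
        (fun v (hv : v ∈ c'.target ∩ c'.symm ⁻¹' (e.trans c).source) => hv.2)).restrict⟩ :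
        C(↥V', EuclideanSpace ℝ (Fin (2 * n)))) =
      ⟨fun v : ↥V' => H (1, v), hHc.comp (Continuous.prodMk_right 1)⟩ :=
    ContinuousMap.ext hptw
  have htrans : relativeSingularHomology.map ℤ ℤ
      (⟨fun v : ↥V' => (e.trans c) (c'.symm v),
        ((e.trans c).continuousOn.comp (c'.continuousOn_symm.mono inter_subset_left)
          (fun v (hv : v ∈ c'.target ∩ c'.symm ⁻¹' (e.trans c).source) => hv.2)).restrict⟩ :
          C(↥V', EuclideanSpace ℝ (Fin (2 * n)))) h (2 * n)
        ((localHomology.openSubsetIso ℤ ℤ hV'o hp' (2 * n)).inv (g.localClass (c' x₀))) =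
      g.localClass (c (e x₀)) := by
    rw [relativeSingularHomology.map.congr_simp ℤ ℤ _ _ hfun h (2 * n)]
    exact hiso
  exact map_localClass_eq_of_transition' g μ₀ μ₁ e hec (mem_univ _) hfib c' hx₀c' hμ₀' c hy₁c' hμ₁
    hp' h htrans

end Isotopy

end Literature.AlgebraicGeometry.HodgeTheory.SmoothFamilyFibreClass

end
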